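import Literature.RepresentationTheory.HeisenbergGroup.SchrodingerL2Haar
import Literature.MeasureTheory.Integral.L2ProdTensorTotal
import HarnessLib

/-!
# The `L²` Schrödinger representation over a product `X₁ × X₂` restricts to the factors as `ρ₁ ⊗ 1` and `1 ⊗ ρ₂`

Topic `RepresentationTheory/HeisenbergGroup`; namespace `Literature.RepresentationTheory.HeisenbergGroup.SchrodingerHaar`.
KERNEL ONLY: theorems; no definition, no named fact, no record, no `sorry`.

The adelic Heisenberg group `H_𝐀(W)` over `𝐀_F = F_∞ × 𝐀_F^∞` contains the commuting, generating images of
`H(W_∞)` and `H(W_fin)` ([GelbartRogawski1991, §3.1 p. 454 L17–21]; `HeisenbergTwoFactors.lean`), and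
`L²(𝐀_Fⁿ) = L²((F ⊗ ℝ)ⁿ × (𝐀_F^∞)ⁿ) = L²(μ_∞ ⊗ μ_fin)`.  This file proves, abstractly, that through these images the
Schrödinger representation `SchrodingerHaar.rep β ψ hψ hβ ν` on `L²(X, ν)` (`SchrodingerL2Haar.lean`; [Weil1964, Chap. I
n° 4, 11–13]) acts on tensors `f ⊗ g ∈ L²(μ₁ ⊗ μ₂)` by the factor representations — the hypotheses `hπt`, `hτt` of
`HeisenbergPairTensorIrreducible.irreducible_tensor_of_irreducible_heisenberg_pair`.

Data: `S : X₁ × X₂ →+ X` additive and measure preserving from `μ₁ ⊗ μ₂` to `ν` with a measure-preserving inverse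
`S'`; additive `k₁ : Y₁ → Y`, `k₂ : Y₂ → Y`, `r₁ : R₁ →+ R`, `r₂ : R₂ →+ R` compatible with the pairings
(`β(S(x₁, 0), k₁ y₁) = r₁ β₁(x₁, y₁)`, `β(S(0, x₂), k₁ y₁) = 0`, and symmetrically) and the characters
(`ψ ∘ r₁ = ψ₁`, `ψ ∘ r₂ = ψ₂`).
* §1 `exists_rep_conj` — transporting a representation along a unitary (`ρ'(g) = U ρ(g) U⁻¹`);
* §2 **`compMeasurePreserving_rep_inl_tensor`** — `(F ↦ F ∘ S) ∘ ρ((S(x₁,0), k₁ y₁), r₁ t₁) ∘ (G ↦ G ∘ S')` maps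
  `f ⊗ g` to `ρ₁((x₁, y₁), t₁) f ⊗ g`; **`compMeasurePreserving_rep_inr_tensor`** — the second factor acts by
  `f ⊗ ρ₂((x₂, y₂), t₂) g`.
Everything is an a.e. computation with Mathlib's `Lp.compMeasurePreserving` and the tensors of
`L2ProdTensorTotal.lean` ([ReedSimonI1980, §II.4]).  Nothing of the cited sources is asserted.

## References
* [Weil1964] A. Weil, Acta Math. 111 (1964), Chap. I n° 4 p. 149, n° 11–13.
* [ReedSimonI1980] M. Reed, B. Simon, *Methods of Modern Mathematical Physics I* (1980), §II.4 Thm II.10.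
* [GelbartRogawski1991] S. Gelbart, J. Rogawski, Invent. Math. 105 (1991), §3.1 p. 454 L17–21.
-/

set_option autoImplicit false

noncomputable section

open MeasureTheory Filter Set
open scoped ENNReal Topology
open Literature.MeasureTheory.Integral

namespace Literature.RepresentationTheory.HeisenbergGroup

namespace SchrodingerHaar

/-! ## §1 Conjugating a representation by a unitary -/

/-- **`ρ'(g) = U ρ(g) U⁻¹`** is a representation on `E'` for a linear isometric equivalence `U : E ≃ E'` (stated as an
existence). [cite: Weil1964, Chap. I n° 11] -/
theorem exists_rep_conj {G : Type*} [Group G] {E E' : Type*} [NormedAddCommGroup E] [NormedSpace ℂ E]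
    [NormedAddCommGroup E'] [NormedSpace ℂ E'] (ρ : Representation ℂ G E) (U : E ≃ₗᵢ[ℂ] E') :
    ∃ ρ' : Representation ℂ G E', ∀ (g : G) (v : E'), ρ' g v = U (ρ g (U.symm v)) := by
  refine ⟨{ toFun := fun g => (U.toLinearEquiv : E →ₗ[ℂ] E') ∘ₗ ρ g ∘ₗ (U.symm.toLinearEquiv : E' →ₗ[ℂ] E)
            map_one' := ?_
            map_mul' := fun g g' => ?_ }, fun g v => rfl⟩
  · apply LinearMap.ext
    intro v
    change U (ρ 1 (U.symm v)) = v
    rw [map_one, Module.End.one_apply, LinearIsometryEquiv.apply_symm_apply]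
  · apply LinearMap.ext
    intro v
    change U (ρ (g * g') (U.symm v)) = U (ρ g (U.symm (U (ρ g' (U.symm v)))))
    rw [map_mul, Module.End.mul_apply, LinearIsometryEquiv.symm_apply_apply]

/-! ## §2 The factor actions on tensors -/

section Pullback

variable {X X₁ X₂ : Type*} [AddCommGroup X] [AddCommGroup X₁] [AddCommGroup X₂]
  [MeasurableSpace X] [MeasurableSpace X₁] [MeasurableSpace X₂] (ν : Measure X) (μ₁ : Measure X₁) (μ₂ : Measure X₂)
  [SigmaFinite μ₂] {S : X₁ × X₂ →+ X} {S' : X → X₁ × X₂} (hS : MeasurePreserving S (μ₁.prod μ₂) ν)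
  (hS' : MeasurePreserving S' ν (μ₁.prod μ₂)) (hS'S : ∀ z, S' (S z) = z)

include hS hS'S in
/-- `(f ⊗ g) ∘ S' ∘ S = f ⊗ g` a.e.: the pull-back to `X` of a tensor, read back on `X₁ × X₂`.
[cite: ReedSimonI1980, §II.4 Theorem II.10] -/
theorem compMeasurePreserving_tensor_comp_ae (f : Lp ℂ 2 μ₁) (g : Lp ℂ 2 μ₂) :
    (⇑(Lp.compMeasurePreserving S' hS' ((memLp_tensor_Lp μ₁ μ₂ f g).toLp _)) ∘ S) =ᵐ[μ₁.prod μ₂]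
      fun z => f z.1 * g z.2 := by
  have aG := hS.quasiMeasurePreserving.ae_eq_comp
    (Lp.coeFn_compMeasurePreserving ((memLp_tensor_Lp μ₁ μ₂ f g).toLp _) hS')
  filter_upwards [aG, MemLp.coeFn_toLp (memLp_tensor_Lp μ₁ μ₂ f g)] with z h1 h2
  rw [h1, Function.comp_apply, Function.comp_apply, hS'S, h2]

end Pullback

section TwoFactors

variable {R R₁ R₂ : Type*} [CommRing R] [CommRing R₁] [CommRing R₂]
  {X Y X₁ Y₁ X₂ Y₂ : Type*} [AddCommGroup X] [Module R X] [AddCommGroup Y] [Module R Y]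
  [AddCommGroup X₁] [Module R₁ X₁] [AddCommGroup Y₁] [Module R₁ Y₁]
  [AddCommGroup X₂] [Module R₂ X₂] [AddCommGroup Y₂] [Module R₂ Y₂]
  (β : X →ₗ[R] Y →ₗ[R] R) (β₁ : X₁ →ₗ[R₁] Y₁ →ₗ[R₁] R₁) (β₂ : X₂ →ₗ[R₂] Y₂ →ₗ[R₂] R₂)
  (ψ : AddChar R Circle) (ψ₁ : AddChar R₁ Circle) (ψ₂ : AddChar R₂ Circle)
  [TopologicalSpace R] [TopologicalSpace R₁] [TopologicalSpace R₂]
  [TopologicalSpace X] [TopologicalSpace X₁] [TopologicalSpace X₂]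
  (hψ : Continuous (ψ : R → Circle)) (hψ₁ : Continuous (ψ₁ : R₁ → Circle)) (hψ₂ : Continuous (ψ₂ : R₂ → Circle))
  (hβ : ∀ y : Y, Continuous fun u : X => β u y) (hβ₁ : ∀ y : Y₁, Continuous fun u : X₁ => β₁ u y)
  (hβ₂ : ∀ y : Y₂, Continuous fun u : X₂ => β₂ u y)
  [MeasurableSpace X] [BorelSpace X] [MeasurableSpace X₁] [BorelSpace X₁] [MeasurableSpace X₂] [BorelSpace X₂]
  (ν : Measure X) (μ₁ : Measure X₁) (μ₂ : Measure X₂)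
  [IsTopologicalAddGroup X] [ν.IsAddRightInvariant] [IsTopologicalAddGroup X₁] [μ₁.IsAddRightInvariant]
  [IsTopologicalAddGroup X₂] [μ₂.IsAddRightInvariant] [SigmaFinite μ₁] [SigmaFinite μ₂]
  {S : X₁ × X₂ →+ X} {S' : X → X₁ × X₂} (hS : MeasurePreserving S (μ₁.prod μ₂) ν)
  (hS' : MeasurePreserving S' ν (μ₁.prod μ₂)) (hS'S : ∀ z, S' (S z) = z)

omit [TopologicalSpace X₂] [BorelSpace X₂] [IsTopologicalAddGroup X₂] [μ₂.IsAddRightInvariant] in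
include hS'S in
/-- **the first factor acts by `ρ₁ ⊗ 1`**: for `h = ((S(x₁, 0), k₁ y₁), r₁ t₁)` (the image of `((x₁, y₁), t₁) ∈ H₁`),
`(ρ(h) (f ⊗ g ∘ S')) ∘ S = ρ₁((x₁, y₁), t₁) f ⊗ g`. [cite: GelbartRogawski1991, §3.1 p. 454 L17–21]
[cite: Weil1964, Chap. I n° 4 p. 149] -/
theorem compMeasurePreserving_rep_inl_tensor {k₁ : Y₁ → Y} {r₁ : R₁ →+ R}
    (h₁ : ∀ (x₁ : X₁) (y₁ : Y₁), β (S (x₁, 0)) (k₁ y₁) = r₁ (β₁ x₁ y₁))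
    (h₂₁ : ∀ (x₂ : X₂) (y₁ : Y₁), β (S (0, x₂)) (k₁ y₁) = 0) (hr₁ : ∀ t : R₁, ψ (r₁ t) = ψ₁ t)
    (x₁ : X₁) (y₁ : Y₁) (t₁ : R₁) (f : Lp ℂ 2 μ₁) (g : Lp ℂ 2 μ₂) :
    Lp.compMeasurePreserving S hS (rep β ψ hψ hβ ν ⟨(S (x₁, 0), k₁ y₁), r₁ t₁⟩
        (Lp.compMeasurePreserving S' hS' ((memLp_tensor_Lp μ₁ μ₂ f g).toLp _))) =
      (memLp_tensor_Lp μ₁ μ₂ (rep β₁ ψ₁ hψ₁ hβ₁ μ₁ ⟨(x₁, y₁), t₁⟩ f) g).toLp _ := by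
  set G := Lp.compMeasurePreserving S' hS' ((memLp_tensor_Lp μ₁ μ₂ f g).toLp _) with hG
  apply Lp.ext
  have hshift : MeasurePreserving (Prod.map (fun a : X₁ => a + x₁) (id : X₂ → X₂)) (μ₁.prod μ₂) (μ₁.prod μ₂) :=
    (measurePreserving_add_right μ₁ x₁).prod (MeasurePreserving.id μ₂)
  have aGS := hshift.quasiMeasurePreserving.ae_eq_comp
    (compMeasurePreserving_tensor_comp_ae ν μ₁ μ₂ hS hS' hS'S f g)
  have aH := hS.quasiMeasurePreserving.ae_eq_comp (rep_coeFn β ψ hψ hβ ν ⟨(S (x₁, 0), k₁ y₁), r₁ t₁⟩ G)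
  have aR := tensor_congr_ae μ₁ μ₂ (rep_coeFn β₁ ψ₁ hψ₁ hβ₁ μ₁ ⟨(x₁, y₁), t₁⟩ f)
    (ae_eq_refl (g : X₂ → ℂ))
  filter_upwards [Lp.coeFn_compMeasurePreserving (rep β ψ hψ hβ ν ⟨(S (x₁, 0), k₁ y₁), r₁ t₁⟩ G) hS, aH, aGS,
    MemLp.coeFn_toLp (memLp_tensor_Lp μ₁ μ₂ (rep β₁ ψ₁ hψ₁ hβ₁ μ₁ ⟨(x₁, y₁), t₁⟩ f) g), aR] with z e1 e2 e3 e4 e5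
  obtain ⟨a, b⟩ := z
  rw [e1, e2, e4, e5]
  simp only [Function.comp_apply, Prod.map_apply, id_eq] at e3 ⊢
  -- `S(a, b) + S(x₁, 0) = S(a + x₁, b)` and the multiplier
  have hz : S (a, b) + S (x₁, 0) = S (a + x₁, b) := by rw [← map_add, Prod.mk_add_mk, add_zero]
  have hβz : β (S (a, b)) (k₁ y₁) = r₁ (β₁ a y₁) := by
    have e : S (a, b) = S (a, 0) + S (0, b) := by rw [← map_add, Prod.mk_add_mk, add_zero, zero_add]
    rw [e, map_add, LinearMap.add_apply, h₁, h₂₁, add_zero]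
  rw [hz, e3, hβz, ← map_add, hr₁, mul_assoc]

omit [TopologicalSpace X₁] [BorelSpace X₁] [IsTopologicalAddGroup X₁] [μ₁.IsAddRightInvariant] in
include hS'S in
/-- **the second factor acts by `1 ⊗ ρ₂`**: for `h = ((S(0, x₂), k₂ y₂), r₂ t₂)`,
`(ρ(h) (f ⊗ g ∘ S')) ∘ S = f ⊗ ρ₂((x₂, y₂), t₂) g`. [cite: GelbartRogawski1991, §3.1 p. 454 L17–21]
[cite: Weil1964, Chap. I n° 4 p. 149] -/
theorem compMeasurePreserving_rep_inr_tensor {k₂ : Y₂ → Y} {r₂ : R₂ →+ R}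
    (h₂ : ∀ (x₂ : X₂) (y₂ : Y₂), β (S (0, x₂)) (k₂ y₂) = r₂ (β₂ x₂ y₂))
    (h₁₂ : ∀ (x₁ : X₁) (y₂ : Y₂), β (S (x₁, 0)) (k₂ y₂) = 0) (hr₂ : ∀ t : R₂, ψ (r₂ t) = ψ₂ t)
    (x₂ : X₂) (y₂ : Y₂) (t₂ : R₂) (f : Lp ℂ 2 μ₁) (g : Lp ℂ 2 μ₂) :
    Lp.compMeasurePreserving S hS (rep β ψ hψ hβ ν ⟨(S (0, x₂), k₂ y₂), r₂ t₂⟩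
        (Lp.compMeasurePreserving S' hS' ((memLp_tensor_Lp μ₁ μ₂ f g).toLp _))) =
      (memLp_tensor_Lp μ₁ μ₂ f (rep β₂ ψ₂ hψ₂ hβ₂ μ₂ ⟨(x₂, y₂), t₂⟩ g)).toLp _ := by
  set G := Lp.compMeasurePreserving S' hS' ((memLp_tensor_Lp μ₁ μ₂ f g).toLp _) with hG
  apply Lp.ext
  have hshift : MeasurePreserving (Prod.map (id : X₁ → X₁) (fun b : X₂ => b + x₂)) (μ₁.prod μ₂) (μ₁.prod μ₂) :=
    (MeasurePreserving.id μ₁).prod (measurePreserving_add_right μ₂ x₂)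
  have aGS := hshift.quasiMeasurePreserving.ae_eq_comp
    (compMeasurePreserving_tensor_comp_ae ν μ₁ μ₂ hS hS' hS'S f g)
  have aH := hS.quasiMeasurePreserving.ae_eq_comp (rep_coeFn β ψ hψ hβ ν ⟨(S (0, x₂), k₂ y₂), r₂ t₂⟩ G)
  have aR := tensor_congr_ae μ₁ μ₂ (ae_eq_refl (f : X₁ → ℂ))
    (rep_coeFn β₂ ψ₂ hψ₂ hβ₂ μ₂ ⟨(x₂, y₂), t₂⟩ g)
  filter_upwards [Lp.coeFn_compMeasurePreserving (rep β ψ hψ hβ ν ⟨(S (0, x₂), k₂ y₂), r₂ t₂⟩ G) hS, aH, aGS,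
    MemLp.coeFn_toLp (memLp_tensor_Lp μ₁ μ₂ f (rep β₂ ψ₂ hψ₂ hβ₂ μ₂ ⟨(x₂, y₂), t₂⟩ g)), aR] with z e1 e2 e3 e4 e5
  obtain ⟨a, b⟩ := z
  rw [e1, e2, e4, e5]
  simp only [Function.comp_apply, Prod.map_apply, id_eq] at e3 ⊢
  have hz : S (a, b) + S (0, x₂) = S (a, b + x₂) := by rw [← map_add, Prod.mk_add_mk, add_zero]
  have hβz : β (S (a, b)) (k₂ y₂) = r₂ (β₂ b y₂) := by
    have e : S (a, b) = S (a, 0) + S (0, b) := by rw [← map_add, Prod.mk_add_mk, add_zero, zero_add]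
    rw [e, map_add, LinearMap.add_apply, h₁₂, h₂, zero_add]
  rw [hz, e3, hβz, ← map_add, hr₂, mul_left_comm]

end TwoFactors

end SchrodingerHaar

end Literature.RepresentationTheory.HeisenbergGroup

end
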